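import Literature.NumberTheory.Sieve.HeathBrownCubicLemma93Core
import Literature.NumberTheory.Sieve.HeathBrownCubicPrimeTuples
import HarnessLib

/-!
# Lemma 9.3: the trivial character ((9.5)–(9.6)) and the window mass ((9.10))

Sequel of `HeathBrownCubicLemma93Core` in the reduction *Lemma 9.2 ⇐ Lemma 9.4* of §9 of D. R. Heath-Brown,
*Primes represented by `x³ + 2y³`*, Acta Math. 186 (2001) (route to `HeathBrown2001_lemma_3_8`). Pages 54–55:
"For the case in which `ν` is trivial we now apply Lemma 4.10. Since `J(m_i) = [X^{m_iξ}, X^{(1+m_i)ξ})` with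
`X^{m_iξ} ≥ X^τ ≥ L`, we may take `ϱ = X^ξ` and `Δ = L`. Moreover we note that `m(𝐱)` is the measure of the set
of `(n+1)`-tuples … In view of the bound `n ≪ τ⁻¹`, the lemma then yields … (9.5) … We therefore conclude that
`E_{j,k} = m(𝐱)M⁻¹(ξ log X)^{−n−1} + O(VM⁻¹ exp{−c(log L)^{1/2}})` (9.6), for the trivial character" and
"In our situation the condition that `(S, q) = 1` is redundant, since, if `d_S` is non-zero, then `S` and
`q` are automatically coprime" (p. 54). This file PROVES these, with Lemma 4.10 in the tree's form
`primeTuples_sub_wMeas_le` (`HeathBrownCubicPrimeTuples`) packaged as the hypothesis `TupleCountBound c₁ c₂ C`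
(`exists_tupleCountBound`):

* `tupleCoeff_eq`, `tupleCoeff_nonneg`, `Eabs_eq_sum`, `Eabs_eq_sub_div` — the window mass is a difference of
  the cumulative sums `T(Y) = ∑_{∏N(P_i) ≤ Y} ∏ log N(P_i)` of Lemma 4.10, divided by `M(ξ log X)^{n+1}`;
* `abs_Eabs_sub_main_le` — `|Eabs(𝐱) − m(𝐱)/(M(ξ log X)^{n+1})| ≤ 2·err(N(𝐱)+ΔV)/(M(ξ log X)^{n+1})`;
* `sup_span_eq_top_of_mem_Jprimes`, `tupleIdeal_sup_span_eq_top` — coprimality to `q` on the support once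
  `q³ < X^τ`; `Ejk_one_zero_zero_eq` — for `χ = χ₀`, `E_{0,0}(𝐱) = Eabs(𝐱)` (`ν^{(0,0)} = 1` there);
  **`norm_Ejk_one_sub_main_le`** — (9.6);
* `wMeas_window_le` — `0 ≤ m(𝐱) = w(N+ΔV) − w(N) ≤ ΔV(ξ log X)^n` ((8.4)), for the trivial bound (9.10).

## References

* D. R. Heath-Brown, *Primes represented by `x³ + 2y³`*, Acta Math. 186 (2001), §9 pp. 54–56, (9.5), (9.6),
  (9.10); Lemma 4.10 (p. 27). [cite: HeathBrownActa2001, §9 (9.6)]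

## Mathlib / tree search

Tree: `primeTuples_sub_wMeas_le`, `HeathBrown2001_lemma_4_10` (`HeathBrownCubicPrimeTuples`), `wMeas_sub_wMeas_eq_integral`,
`wDeriv_le`, `wDeriv_nonneg`, `intervalIntegrable_wDeriv` (`HeathBrownCubicWCalculus`), `one_le_prod_of_coreAdmissible`,
`mem_Jprimes_iff` (`HeathBrownCubicTypeII`), `absNorm_span_natCast_K`, `isTrivialMod_grossenChar_one` (`HeathBrownCubicGrossen`),
`Ejk`, `Eabs` (`HeathBrownCubicLemma93Core`). Mathlib: `Ideal.prod_sup_eq_top`, `Ideal.IsPrime.isMaximal`,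
`Ideal.absNorm_dvd_absNorm_of_le`.
-/

noncomputable section

open Polynomial NumberField Finset Complex MeasureTheory

namespace Literature.NumberTheory.Sieve.CubicSieve

open LFunctions.CubeRootTwoField CubicPrimes Literature.Analysis.Fourier

variable {X τ : ℝ} {n : ℕ} {m : Fin (n + 1) → ℕ}

/-! ### The coefficients `∏ log N(P_i)/(m_i ξ log X)` -/

/-- The tuple coefficient is `(∏ log N(P_i))/(M (ξ log X)^{n+1})`, `M = ∏ m_i`. [folklore] -/
theorem tupleCoeff_eq (P : Fin (n + 1) → Ideal (𝓞 K)) :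
    tupleCoeff X τ m P = (∏ i, Real.log (Ideal.absNorm (P i))) / ((∏ i, (m i : ℝ)) * (hbXi τ * Real.log X) ^ (n + 1)) := by
  rw [tupleCoeff, Finset.prod_div_distrib]
  congr 1
  rw [Finset.prod_mul_distrib, Finset.prod_mul_distrib, Finset.prod_const, Finset.prod_const, Finset.card_univ,
    Fintype.card_fin]
  ring

/-- The tuple coefficient is non-negative (`X > 1`, `τ > 0`). [folklore] -/
theorem tupleCoeff_nonneg (hX : 1 < X) (hτ : 0 < τ) (P : Fin (n + 1) → Ideal (𝓞 K)) : 0 ≤ tupleCoeff X τ m P := by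
  rw [tupleCoeff]
  refine Finset.prod_nonneg fun i _ => div_nonneg (Real.log_natCast_nonneg _) ?_
  have := hbXi_pos hτ; have := Real.log_pos hX
  positivity

/-- `Eabs` without absolute values (`X > 1`, `τ > 0`). [folklore] -/
theorem Eabs_eq_sum (hX : 1 < X) (hτ : 0 < τ) (Δ V : ℝ) (x : ℝ × ℝ × ℝ) :
    Eabs X τ m Δ V x = ∑ P ∈ primeTuples X τ m, if InNormWindow Δ V x P then tupleCoeff X τ m P else 0 := by
  refine Finset.sum_congr rfl fun P _ => ?_
  split_ifs
  · exact abs_of_nonneg (tupleCoeff_nonneg hX hτ P)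
  · rfl

/-- **The window mass as a difference of the cumulative sums of Lemma 4.10**:
`∑_{window} c_P = (T(N+ΔV) − T(N))/(M(ξ log X)^{n+1})`, `T(Y) = ∑_{∏N(P_i) ≤ Y} ∏ log N(P_i)`. [folklore] -/
theorem Eabs_eq_sub_div (hX : 1 < X) (hτ : 0 < τ) {Δ V : ℝ} (hΔV : 0 ≤ Δ * V) (x : ℝ × ℝ × ℝ) :
    Eabs X τ m Δ V x =
      ((∑ P ∈ primeTuples X τ m, if ∏ i, (Ideal.absNorm (P i) : ℝ) ≤ normForm x + Δ * V then ∏ i, Real.log (Ideal.absNorm (P i)) else 0) -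
        (∑ P ∈ primeTuples X τ m, if ∏ i, (Ideal.absNorm (P i) : ℝ) ≤ normForm x then ∏ i, Real.log (Ideal.absNorm (P i)) else 0)) /
        ((∏ i, (m i : ℝ)) * (hbXi τ * Real.log X) ^ (n + 1)) := by
  rw [Eabs_eq_sum hX hτ, ← Finset.sum_sub_distrib, Finset.sum_div]
  refine Finset.sum_congr rfl fun P _ => ?_
  rw [tupleCoeff_eq]
  simp only [InNormWindow, tupleNorm]
  by_cases h1 : normForm x < ∏ i, (Ideal.absNorm (P i) : ℝ)
  · by_cases h2 : ∏ i, (Ideal.absNorm (P i) : ℝ) ≤ normForm x + Δ * V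
    · rw [if_pos ⟨h1, h2⟩, if_pos h2, if_neg (not_le.mpr h1), sub_zero]
    · rw [if_neg (fun h => h2 h.2), if_neg h2]
      by_cases h3 : ∏ i, (Ideal.absNorm (P i) : ℝ) ≤ normForm x
      · exact absurd h3 (not_le.mpr h1)
      · rw [if_neg h3, sub_zero, zero_div]
  · rw [if_neg (fun h => h1 h.1)]
    push Not at h1
    have h2 : ∏ i, (Ideal.absNorm (P i) : ℝ) ≤ normForm x + Δ * V := h1.trans (by linarith)
    rw [if_pos h2, if_pos h1, sub_self, zero_div]

/-! ### (9.5)–(9.6): the window mass and `E_{0,0}` from Lemma 4.10 -/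

/-- The shape of the conclusion of `primeTuples_sub_wMeas_le` (Lemma 4.10 for the boxes `∏ J(m_i)`) with
given constants, as a hypothesis of the next statements. [cite: HeathBrownActa2001, Lemma 4.10] -/
def TupleCountBound (c₁ c₂ C : ℝ) : Prop :=
  ∀ (X τ : ℝ), 1 < X → 0 < τ → τ ≤ 1 → 3 ≤ X ^ τ →
    ∀ (n : ℕ) (m : Fin (n + 1) → ℕ), CoreAdmissible τ m → ∀ Y : ℝ, 0 < Y →
      |(∑ P ∈ Fintype.piFinset fun i => Jprimes X τ (m i),
          if ∏ i, (Ideal.absNorm (P i) : ℝ) ≤ Y then ∏ i, Real.log (Ideal.absNorm (P i)) else 0) -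
        wMeas X τ m Y| ≤
      C * ((n : ℝ) + 1) * Y * (c₁ + hbXi τ * Real.log X) ^ n * Real.exp (-c₂ * Real.sqrt (τ * Real.log X))

/-- Lemma 4.10 supplies such constants. [cite: HeathBrownActa2001, Lemma 4.10] -/
theorem exists_tupleCountBound : ∃ c₁ c₂ C : ℝ, 0 ≤ c₁ ∧ 0 < c₂ ∧ 0 ≤ C ∧ TupleCountBound c₁ c₂ C :=
  primeTuples_sub_wMeas_le

/-- **(9.5)–(9.6) for the window mass**: `|Eabs(𝐱) − m(𝐱)/(M(ξ log X)^{n+1})| ≤ 2·err/(M(ξ log X)^{n+1})`,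
`m(𝐱) = w(N(𝐱)+ΔV) − w(N(𝐱))`, `err = C(n+1)(N(𝐱)+ΔV)(c₁+ξ log X)^n e^{−c₂√(τ log X)}`.
[cite: HeathBrownActa2001, §9 (9.6)] -/
theorem abs_Eabs_sub_main_le {c₁ c₂ C : ℝ} (h410 : TupleCountBound c₁ c₂ C) (hc₁ : 0 ≤ c₁) (hC : 0 ≤ C)
    (hX : 1 < X) (hτ : 0 < τ) (hτ1 : τ ≤ 1) (h3 : 3 ≤ X ^ τ) (hm : CoreAdmissible τ m)
    {Δ V : ℝ} (hΔV : 0 ≤ Δ * V) {x : ℝ × ℝ × ℝ} (hNx : 0 < normForm x) :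
    |Eabs X τ m Δ V x - (wMeas X τ m (normForm x + Δ * V) - wMeas X τ m (normForm x)) /
        ((∏ i, (m i : ℝ)) * (hbXi τ * Real.log X) ^ (n + 1))| ≤
      2 * (C * ((n : ℝ) + 1) * (normForm x + Δ * V) * (c₁ + hbXi τ * Real.log X) ^ n * Real.exp (-c₂ * Real.sqrt (τ * Real.log X))) /
        ((∏ i, (m i : ℝ)) * (hbXi τ * Real.log X) ^ (n + 1)) := by
  have hM : 0 < (∏ i, (m i : ℝ)) * (hbXi τ * Real.log X) ^ (n + 1) := by
    have := one_le_prod_of_coreAdmissible hτ hτ1 hm; have := hbXi_pos hτ; have := Real.log_pos hX; positivity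
  rw [Eabs_eq_sub_div hX hτ hΔV, ← sub_div, abs_div, abs_of_pos hM, div_le_div_iff_of_pos_right hM]
  have h1 := h410 X τ hX hτ hτ1 h3 n m hm (normForm x + Δ * V) (by linarith)
  have h2 := h410 X τ hX hτ hτ1 h3 n m hm (normForm x) hNx
  have hmono : C * ((n : ℝ) + 1) * normForm x * (c₁ + hbXi τ * Real.log X) ^ n * Real.exp (-c₂ * Real.sqrt (τ * Real.log X)) ≤
      C * ((n : ℝ) + 1) * (normForm x + Δ * V) * (c₁ + hbXi τ * Real.log X) ^ n * Real.exp (-c₂ * Real.sqrt (τ * Real.log X)) := by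
    have := hbXi_pos hτ; have := Real.log_pos hX
    gcongr; linarith
  rw [abs_le] at h1 h2 ⊢
  constructor <;> nlinarith [h1.1, h1.2, h2.1, h2.2, hmono]

/-- A first-degree prime of `J(m_i)` is coprime to `q` once `q³ < X^τ` (`N(P) ≥ X^{m_iξ} ≥ X^τ > q³`, while a
prime containing `q` has norm dividing `q³`). [cite: HeathBrownActa2001, §9 p. 54] -/
theorem sup_span_eq_top_of_mem_Jprimes (hX : 1 < X) (hτ : 0 < τ) (hm : CoreAdmissible τ m) {q : ℕ} (hq : 1 ≤ q)
    (hqX : (q : ℝ) ^ 3 < X ^ τ) {i : Fin (n + 1)} {P : Ideal (𝓞 K)} (hP : P ∈ Jprimes X τ (m i)) :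
    P ⊔ Ideal.span {((q : ℕ) : 𝓞 K)} = ⊤ := by
  rw [mem_Jprimes_iff] at hP
  obtain ⟨hPp, hP0, hlo, -, -⟩ := hP
  have hmax : P.IsMaximal := Ideal.IsPrime.isMaximal hPp hP0
  -- `q ∉ P`
  have hqP : ((q : ℕ) : 𝓞 K) ∉ P := by
    intro hqP
    have hdvd : Ideal.absNorm P ∣ q ^ 3 := by
      rw [← absNorm_span_natCast_K q]
      exact Ideal.absNorm_dvd_absNorm_of_le ((Ideal.span_singleton_le_iff_mem _).mpr hqP)
    have hle3 : (Ideal.absNorm P : ℝ) ≤ (q : ℝ) ^ 3 := by exact_mod_cast Nat.le_of_dvd (pow_pos hq 3) hdvd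
    have hlow : X ^ τ ≤ (Ideal.absNorm P : ℝ) := by
      refine le_trans (Real.rpow_le_rpow_of_exponent_le hX.le ?_) hlo
      have := hm.2.1 i
      rwa [div_le_iff₀ (hbXi_pos hτ)] at this
    linarith
  -- maximality
  have hlt : P < P ⊔ Ideal.span {((q : ℕ) : 𝓞 K)} :=
    lt_of_le_of_ne le_sup_left fun h => hqP (h ▸ Ideal.mem_sup_right (Ideal.mem_span_singleton_self _))
  exact hmax.1.2 _ hlt

/-- The product ideal of a tuple in the support is coprime to `q` (`q³ < X^τ`). [cite: HeathBrownActa2001, §9 p. 54] -/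
theorem tupleIdeal_sup_span_eq_top (hX : 1 < X) (hτ : 0 < τ) (hm : CoreAdmissible τ m) {q : ℕ} (hq : 1 ≤ q)
    (hqX : (q : ℝ) ^ 3 < X ^ τ) {P : Fin (n + 1) → Ideal (𝓞 K)} (hP : P ∈ primeTuples X τ m) :
    tupleIdeal P ⊔ Ideal.span {((q : ℕ) : 𝓞 K)} = ⊤ := by
  rw [tupleIdeal]
  exact Ideal.prod_sup_eq_top fun i _ => sup_span_eq_top_of_mem_Jprimes hX hτ hm hq hqX (Fintype.mem_piFinset.mp hP i)

/-- **For the trivial character `E_{0,0}(𝐱)` is the window mass**: `ν^{(0,0)}(S) = χ₀(S) = 1` on the support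
(`q³ < X^τ`; "if `d_S` is non-zero, then `S` and `q` are automatically coprime", p. 54). [cite: HeathBrownActa2001, §9 p. 54] -/
theorem Ejk_one_zero_zero_eq (hX : 1 < X) (hτ : 0 < τ) (hm : CoreAdmissible τ m) {q : ℕ} (hq : 1 ≤ q)
    (hqX : (q : ℝ) ^ 3 < X ^ τ) (Δ V : ℝ) (x : ℝ × ℝ × ℝ) :
    Ejk X τ m hq (1 : MulChar (QuotMod q) ℂ) 0 0 Δ V x = (Eabs X τ m Δ V x : ℂ) := by
  rw [Ejk, Eabs_eq_sum hX hτ, Complex.ofReal_sum]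
  refine Finset.sum_congr rfl fun P hP => ?_
  split_ifs with hw
  · rw [isTrivialMod_grossenChar_one hq (tupleIdeal P) (tupleIdeal_ne_bot hP) (tupleIdeal_sup_span_eq_top hX hτ hm hq hqX hP),
      mul_one]
  · simp

/-- **(9.6) for `E_{0,0}`** (`χ = χ₀`): `|E_{0,0}(𝐱) − m(𝐱)/(M(ξ log X)^{n+1})| ≤ 2·err/(M(ξ log X)^{n+1})`.
[cite: HeathBrownActa2001, §9 (9.6)] -/
theorem norm_Ejk_one_sub_main_le {c₁ c₂ C : ℝ} (h410 : TupleCountBound c₁ c₂ C) (hc₁ : 0 ≤ c₁) (hC : 0 ≤ C)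
    (hX : 1 < X) (hτ : 0 < τ) (hτ1 : τ ≤ 1) (h3 : 3 ≤ X ^ τ) (hm : CoreAdmissible τ m) {q : ℕ} (hq : 1 ≤ q)
    (hqX : (q : ℝ) ^ 3 < X ^ τ) {Δ V : ℝ} (hΔV : 0 ≤ Δ * V) {x : ℝ × ℝ × ℝ} (hNx : 0 < normForm x) :
    ‖Ejk X τ m hq (1 : MulChar (QuotMod q) ℂ) 0 0 Δ V x -
        ((wMeas X τ m (normForm x + Δ * V) - wMeas X τ m (normForm x)) / ((∏ i, (m i : ℝ)) * (hbXi τ * Real.log X) ^ (n + 1)) : ℝ)‖ ≤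
      2 * (C * ((n : ℝ) + 1) * (normForm x + Δ * V) * (c₁ + hbXi τ * Real.log X) ^ n * Real.exp (-c₂ * Real.sqrt (τ * Real.log X))) /
        ((∏ i, (m i : ℝ)) * (hbXi τ * Real.log X) ^ (n + 1)) := by
  rw [Ejk_one_zero_zero_eq hX hτ hm hq hqX, ← Complex.ofReal_sub, Complex.norm_real, Real.norm_eq_abs]
  exact abs_Eabs_sub_main_le h410 hc₁ hC hX hτ hτ1 h3 hm hΔV hNx

/-- **The window of `w`**: `0 ≤ w(t + h) − w(t) ≤ h (ξ log X)^n` for `h ≥ 0` ((8.4): `0 ≤ w' ≤ (ξ log X)^n`).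
[cite: HeathBrownActa2001, §8 (8.4)] -/
theorem wMeas_window_le (hX : 1 ≤ X) (hτ : 0 ≤ τ) {t h : ℝ} (hh : 0 ≤ h) :
    0 ≤ wMeas X τ m (t + h) - wMeas X τ m t ∧ wMeas X τ m (t + h) - wMeas X τ m t ≤ h * (hbXi τ * Real.log X) ^ n := by
  have hX0 : 0 < X := by linarith
  rw [wMeas_sub_wMeas_eq_integral hX hτ m (by linarith : t ≤ t + h)]
  constructor
  · exact intervalIntegral.integral_nonneg (by linarith) fun u _ => wDeriv_nonneg hX0 m u
  · have := intervalIntegral.integral_mono_on (by linarith : t ≤ t + h) (intervalIntegrable_wDeriv hX hτ m t (t + h))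
      intervalIntegrable_const (fun u _ => wDeriv_le hX hτ m u)
    rw [intervalIntegral.integral_const, smul_eq_mul] at this
    convert this using 1; ring

end Literature.NumberTheory.Sieve.CubicSieve



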